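import Summits.QuantumFields.BalabanUV.Beta.FP.TowerFTransportRow
import Summits.QuantumFields.BalabanUV.Beta.FP.TowerFChartLetters
import Summits.QuantumFields.BalabanUV.Beta.FP.PackedLegCombSym

/-!
# `BalabanUV.Beta.FP.TowerFAnchorRow` — road «FP», binder row D1, ROUTE T (β1), (H5-F)∕(H6): **THE END's DEPTH-1 ANCHOR `hF₁` BY NAME, AND STOREY 1 OF THE F-TOWER
# AT THE OBJECT `JcComp` ITSELF NAMES** — `JcComp` is a THREE-way match (`CompositeOneShotJetData`: depth `1 := JcOf … 1` = ROOT M‴'s one-shot literal, BY FIAT;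
# depth `m+2 := pullJ (JNat (m+2))`), so the F-system of v10 `StepRecursionFeedNestedNamedI` at storey `1` is the `wStep Lc 1`-DRESSING OF THE LITERAL's LEVEL-0 PAIR
# `(G′₀, VG⁰, WG⁰) := (GcombSh Lc 0, vertexOfK G′₀ Lc (JsB12CombSh⁰ … 0).S, (JsB12CombSh⁰ … 0).W)` (`CombChartJointEnd.TbalOf_JsB12CombShSym`), NOT of the unread
# N-system `(AN 0, VN 0, WN 0)`; at that choice `hF₁` (v10 L.276) is a THEOREM, CHARACTER FOR CHARACTER, and the storey-1 twins of the F-chart letters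
# `hEAF hAEF hAFsh hAF hαF hVF hWF hδF` hold by name

WHY (located).  v10 reads the N-system only at `n+1` (L.358) and its `htr` carries `1 ≤ j`; `CompositeOneShotJetData.hN_JcComp` is `j ≥ 1` for the same reason:
`TshotOf Lc JcComp 1 = TbalOf Lc Js 0` (`TshotOf_JcComp_one`), the literal's level-0 balanced kernel.  The road's END skeletons J–M (g58 xreads) instantiated
`𝒱F := match · with | 0 => 0 | k+1 => dressed (VN k)`, which at `k = 0` drags in the unread `VN 0` and leaves `hF₁` DISPLAYED as an unwanted located junction.  The
END at the record should mirror `JcComp`: storey `1` := the dressed literal pair (this file), storey `k+2` := the dressed N-system `k+1` (`TowerFTransportRow`,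
`TowerFChartLetters`, `TowerFFamilyParities`, `TowerFWoundParities` at index `k+1`).  Skeleton N (road xread) does exactly that; `hF₁` leaves the displayed census.

WHAT ([folklore] composition BY NAME; no `def`, no `def … : Prop`, nothing cited, 0 sorry).  σ₀ := `Sum.elim 1 (uF 0)⁻¹`, σ′₀ := `Sum.elim 1 (uF 0)`.
* §1 the literal's level-0 letters in FILE 2's hypothesis shapes: `VG0_translate` (lit `vertexOfK_translate_block` ← an2 `CombChartStepJets.shiftK_GcombSh` +
  `JsB12CombSh0_S_translate`), `vertexFamilies_G0` (lit `vertexFamily_vertexOfK'` ← `decays_GcombSh` + the jet record's own `loc`; `loc₂`; one common rate).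
* §2 storey-1 chart letters at `AF 1 := scaleK σ₀ σ₀ G′₀`: **`hEAF_zero ∕ hAEF_zero`** (v10 L.239∕240 at `n := 0`; road `TowerNAxialLetters.perF_rules_scaleK` over
  `PackedLegCombSym.perF_rules_combSym`), **`hAFsh_zero`** (L.238 at `n := 0`; `TowerSigmaLegLetters.shiftK_scaleK` + `RelInvPeriodisedComb.shiftK_GcombSh'`),
  **`exists_decays_AF_zero`** (`hAF hαF` in `∃`-form; lit `decays_scaleK`).
* §3 **`exists_vertexFamilies_FRec_zero`** — the σ′₀-scaled dressed literal families are `VertexFamily ∕ VertexFamily₂` at blocking `Lc·Lc` (v10's `hVF hWF hδF` at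
  `n := 0`; FILE 1 `vertexFamily_dressV ∕ vertexFamily₂_dressW`).
* §4 **`hF₁_rec`** — v10's `hF₁` CHARACTER FOR CHARACTER under σ₀ = {`(AF 1)` ↦ the σ₀-chart, `(𝒱F 1)` ↦ `fun μ y => scaleK σ′₀ σ′₀ (Lc⁴ • dressV Lc Lc (wStep Lc 1) VG⁰ μ y)`,
  `(𝒲F 1)` ↦ `fun μ y ν y' => scaleK σ′₀ σ′₀ (Lc⁸ • dressW Lc Lc (wStep Lc 1) WG⁰ μ y ν y')`}: units out (lit `hessKer_scaleK`), `TshotOf_JcComp_one`,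
  `TbalOf_JsB12CombShSym`, FILE 2's `hessKer_dressV_dressW` at `N := Lc`, `L := Lc`, `w := wStep Lc 1`.  Junction by script `g58/rec/mkAnchor.py` (4∕4).
WHAT THIS IS NOT: not the storey-1 parities `hVFm hVFt hWFm hWFt` (next file, from leaf BF-x `LiteralStencilSockets`); not the displayed box-side letters
`hXF hLF hWFw hHF₁ hQF₁ hHF₂ hQF₂` at storey 1; nothing of Bałaban's asserted, valued or discharged; 0 estimates; v10 ∕ END NOT filed (policy); 0∕4 row-D1 binders;
NOT (C1), NOT (T-ID), NOT D1, NEVER «G-an2-4 closed», NOT BetaPertH, NOT continuum, NOT Clay.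
HONEST DEPENDENCY (page 1, mandatory): continuum YM on T⁴ ⇐ BetaPertH ∧ nine spine estimates (0/9 proved); BetaPertH ⇐ (D1) ∧ (D4) ∧ CAP+tail;
G-an2-4 gates asym, D1 and NE2/3/4.  HONEST FRAMING (cell contract, verbatim): «discharging `BetaPertH` makes Bałaban's UV stability UNCONDITIONAL —
a real constructive-QFT result; it is NOT the continuum limit and NOT the Clay problem.»  ABSOLUTE RULE (cell charter, verbatim): «No internally-minted
statement may enter as a cited fact. Every hypothesis is either kernel-proved in this package or a verbatim quotation of a PUBLISHED theorem with page
reference. The manuscript(s) under audit are NOT citable for their own disputed steps — they are the thing under adjudication; programme-internal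
(2001/route/tribunal) claims are never citable.»  Road «FP» OWNER, b2b-balaban-beta-d1-p3 gen 58, 2026-08-29.  No existing file touched.
-/

noncomputable section

open scoped BigOperators Matrix

namespace Summit.QuantumFields.BalabanUV.Beta.FP.TowerFAnchorRow

open Matrix Finset
open Literature.MathematicalPhysics.QuantumFieldTheory
open Literature.MathematicalPhysics.QuantumFieldTheory.Balaban1983to89
open Literature.MathematicalPhysics.QuantumFieldTheory.Balaban1983to89.Beta
open B5Prop11Plancherel (fine)
open B12Sec2to5 (l1)
open AffineAveraging (Site box toSite)
open AveragingContoursRooted (ctr ctrOff)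
open OneStepResolventKernel (Fib biLoc_mono)
open OneStepKernelFamily (vertexOfK TshotOf vertexFamily_vertexOfK')
open ExpKernelCalculus (MKer Decays BiLoc VertexFamily VertexFamily₂ shiftK hessKer bubble tadpole)
open DressedMomentNormalisation (EKer dressedEntry)
open HessKerRate (scaleK hessKer_scaleK biLoc_scaleK decays_scaleK)
open SecondOrderResponse (biLoc_smul)
open KernelReflection (bubble_smul_left bubble_smul_right tadpole_smul)
open HessianTelescopingKKT (wStep)
open BalabanStepJets (vertexFamily₂_mono)
open BalabanStepJetsSucc (vertexOfK_translate_block)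
open Summit.QuantumFields.BalabanUV.Beta.TameKernelCalculus (Spr biLoc_of_le)
open Summit.QuantumFields.BalabanUV.Beta.AxialDressingRooted (axEc)
open Summit.QuantumFields.BalabanUV.Beta.SymSecondOrderTablesAn1 (symTablesAn1S2)
open Summit.QuantumFields.BalabanUV.Beta.CombChartStepJets (GcombSh decays_GcombSh shiftK_GcombSh JsB12CombSh0 JsB12CombSh0_S_translate JsB12CombSh0_W_translate)
open Summit.QuantumFields.BalabanUV.Beta.CombChartJointEnd (TbalOf_JsB12CombShSym)
open Summit.QuantumFields.BalabanUV.Beta.CompositeOneShotJetData (Roots Pins JcComp TshotOf_JcComp_one)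
open Summit.QuantumFields.BalabanUV.Beta.FP.KernelPeriodisationFib (Idx perF)
open Summit.QuantumFields.BalabanUV.Beta.FP.TorusCompositeObjects (towerTorus)
open Summit.QuantumFields.BalabanUV.Beta.FP.TowerNAxialLetters (perF_rules_scaleK)
open Summit.QuantumFields.BalabanUV.Beta.FP.PackedLegCombSym (perF_rules_combSym)
open Summit.QuantumFields.BalabanUV.Beta.FP.RelInvPeriodisedComb (shiftK_GcombSh')
open Summit.QuantumFields.BalabanUV.Beta.FP.TowerSigmaLegLetters (shiftK_scaleK abs_fibSigma'_le)
open Summit.QuantumFields.BalabanUV.Beta.FP.NestedConstraintScaling (fibreScale_mul_inv)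
open Summit.QuantumFields.BalabanUV.Beta.FP.KernelStepDressing (dressV dressW vertexFamily_dressV vertexFamily₂_dressW)
open Summit.QuantumFields.BalabanUV.Beta.FP.KernelStepDressingHessKer (hessKer_dressV_dressW)
open Summit.QuantumFields.BalabanUV.Beta.FP.TowerFTransportRow (abs_wStep_le)

/-! ## §1 The literal's level-0 letters in FILE 2's hypothesis shapes -/

section Letters

variable (Lc : ℕ) [NeZero Lc] (hLc : Odd Lc) (N : ℕ) (cΛ cB : ℝ)

/-- [folklore] **BLOCK COVARIANCE OF THE LITERAL's LEVEL-0 FIRST-ORDER FAMILY** `VG⁰ := vertexOfK G′₀ Lc (JsB12CombSh⁰ … 0).S`: the comb chart is `Lc`-block invariant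
(an2 `shiftK_GcombSh`) and the raw literal's stencils are block covariant (`JsB12CombSh0_S_translate`), so lit `vertexOfK_translate_block` applies. -/
theorem VG0_translate (c : Fin (3 + 1)) (t s : Fin (3 + 1) → ℤ) :
    vertexOfK (GcombSh (d := 3) Lc 0) Lc (JsB12CombSh0 hLc N (symTablesAn1S2 3 Lc cΛ) cΛ cB 0).S c (t + s)
      = shiftK (-((Lc : ℤ) • s)) (vertexOfK (GcombSh (d := 3) Lc 0) Lc (JsB12CombSh0 hLc N (symTablesAn1S2 3 Lc cΛ) cΛ cB 0).S c t) :=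
  vertexOfK_translate_block (N := Lc) (fun t' => shiftK_GcombSh (d := 3) Lc 0 t')
    (fun κ' u t' => JsB12CombSh0_S_translate hLc N (symTablesAn1S2 3 Lc cΛ) cΛ cB 0 κ' u t') c t s

/-- [folklore] **THE LITERAL's LEVEL-0 PAIR ARE VERTEX FAMILIES AT BLOCKING `Lc` WITH ONE COMMON RATE**: lit `vertexFamily_vertexOfK'` (decay of `G′₀` + the jet record's
own `loc`) and the record's own `loc₂`, the rates `min`-ed. -/
theorem vertexFamilies_G0 : ∃ Cv Cw δ : ℝ, 0 < δ ∧
    VertexFamily (vertexOfK (GcombSh (d := 3) Lc 0) Lc (JsB12CombSh0 hLc N (symTablesAn1S2 3 Lc cΛ) cΛ cB 0).S) Lc Cv δ ∧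
    VertexFamily₂ (JsB12CombSh0 hLc N (symTablesAn1S2 3 Lc cΛ) cΛ cB 0).W Lc Cw δ := by
  set J := JsB12CombSh0 hLc N (symTablesAn1S2 3 Lc cΛ) cΛ cB 0 with hJ
  obtain ⟨Cv, δv, hδv, hV⟩ := vertexFamily_vertexOfK' (N := Lc) (K := GcombSh (d := 3) Lc 0) (decays_GcombSh (d := 3) Lc 0) J.loc J.δ_pos
  have hW : VertexFamily₂ J.W Lc J.Cw J.δ := J.loc₂
  have hCv : 0 ≤ Cv := (hV 0 0).nonneg (Sum.inl 0)
  have hCw : 0 ≤ J.Cw := (hW 0 0 0 0).nonneg (Sum.inl 0)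
  exact ⟨Cv, J.Cw, min δv J.δ, lt_min hδv J.δ_pos, fun μ y => biLoc_mono (hV μ y) hCv (min_le_left _ _),
    vertexFamily₂_mono hW hCw (min_le_right _ _)⟩

end Letters

/-! ## §2 Storey-1 chart letters at `AF 1 := scaleK σ₀ σ₀ (GcombSh Lc 0)` — v10's `hEAF hAEF hAFsh` at `n := 0`, and `hAF hαF` in `∃`-form -/

section Chart

variable (Lc : ℕ) [NeZero Lc] (Mc : ℕ → (Fin (3 + 1) → ℕ)) [∀ B μ, NeZero (Mc B μ)] (uF : ℕ → ℝ)

/-- [folklore] **`hEAF` AT STOREY 1** — v10's binder `hEAF` (L.239) AT `n := 0`, CHARACTER FOR CHARACTER under σ₀ = {`(AF (0 + 1))` ↦ `scaleK σ₀ σ₀ (GcombSh Lc 0)`,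
`(ρF 0)` ↦ `ctr 4 (Lc ^ (0 + 1))`, `(LFc 0)` ↦ `Lc ^ (0 + 1)`}: the left torus rule of the unit-conjugated comb chart on the finest torus of box `B`
(`perF_rules_combSym` at `M′ := fine Lc (fine Lc (Mc B))` — which IS `towerTorus Lc (fine Lc (Mc B)) (0 + 1)` — through `perF_rules_scaleK`; `Lc ^ (0 + 1) = Lc`; oddness of `Lc` is NOT needed at storey 1). -/
theorem hEAF_zero : ∀ B : ℕ, perF (towerTorus Lc (fine Lc (Mc B)) (0 + 1)) (axEc (ctr (3 + 1) (Lc ^ (0 + 1))) (Lc ^ (0 + 1))) * perF (towerTorus Lc (fine Lc (Mc B)) (0 + 1)) (scaleK (Sum.elim (fun _ : Fin (3 + 1) => (1 : ℝ)) (fun _ : Fin (3 + 1) => (uF 0)⁻¹)) (Sum.elim (fun _ : Fin (3 + 1) => (1 : ℝ)) (fun _ : Fin (3 + 1) => (uF 0)⁻¹)) (GcombSh (d := 3) Lc 0)) = perF (towerTorus Lc (fine Lc (Mc B)) (0 + 1)) (scaleK (Sum.elim (fun _ : Fin (3 + 1) => (1 : ℝ)) (fun _ : Fin (3 + 1) =>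 (uF 0)⁻¹)) (Sum.elim (fun _ : Fin (3 + 1) => (1 : ℝ)) (fun _ : Fin (3 + 1) => (uF 0)⁻¹)) (GcombSh (d := 3) Lc 0)) := by
  intro B
  rw [pow_one]
  have h := perF_rules_combSym (d := 3) (fine Lc (fine Lc (Mc B))) (fun i => ⟨Lc * Mc B i, by show Lc * (Lc * Mc B i) = _; rfl⟩) 0
  exact (perF_rules_scaleK (fine Lc (fine Lc (Mc B))) _ _ (GcombSh (d := 3) Lc 0) _ _ h.1 h.2).1

/-- [folklore] **`hAEF` AT STOREY 1** — v10's binder `hAEF` (L.240) AT `n := 0` under the same σ₀: the right torus rule. -/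
theorem hAEF_zero : ∀ B : ℕ, perF (towerTorus Lc (fine Lc (Mc B)) (0 + 1)) (scaleK (Sum.elim (fun _ : Fin (3 + 1) => (1 : ℝ)) (fun _ : Fin (3 + 1) => (uF 0)⁻¹)) (Sum.elim (fun _ : Fin (3 + 1) => (1 : ℝ)) (fun _ : Fin (3 + 1) => (uF 0)⁻¹)) (GcombSh (d := 3) Lc 0)) * perF (towerTorus Lc (fine Lc (Mc B)) (0 + 1)) (axEc (ctr (3 + 1) (Lc ^ (0 + 1))) (Lc ^ (0 + 1))) = perF (towerTorus Lc (fine Lc (Mc B)) (0 + 1)) (scaleK (Sum.elim (fun _ : Fin (3 + 1) => (1 : ℝ)) (fun _ : Fin (3 + 1) => (uF 0)⁻¹)) (Sum.elim (fun _ : Fin (3 + 1) => (1 : ℝ)) (fun _ : Fin (3 + 1) => (uF 0)⁻¹)) (GcombSh (d := 3) Lc 0)) := by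
  intro B
  rw [pow_one]
  have h := perF_rules_combSym (d := 3) (fine Lc (fine Lc (Mc B))) (fun i => ⟨Lc * Mc B i, by show Lc * (Lc * Mc B i) = _; rfl⟩) 0
  exact (perF_rules_scaleK (fine Lc (fine Lc (Mc B))) _ _ (GcombSh (d := 3) Lc 0) _ _ h.1 h.2).2

/-- [folklore] **`hAFsh` AT STOREY 1** — v10's binder `hAFsh` (L.238) AT `n := 0` under σ₀: `Lc`-block covariance of the unit-conjugated comb chart (`shiftK_scaleK` is
`rfl`; `RelInvPeriodisedComb.shiftK_GcombSh'`). -/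
theorem hAFsh_zero : ∀ t : Fin (3 + 1) → ℤ, shiftK (((Lc ^ (0 + 1) : ℕ) : ℤ) • t) (scaleK (Sum.elim (fun _ : Fin (3 + 1) => (1 : ℝ)) (fun _ : Fin (3 + 1) => (uF 0)⁻¹)) (Sum.elim (fun _ : Fin (3 + 1) => (1 : ℝ)) (fun _ : Fin (3 + 1) => (uF 0)⁻¹)) (GcombSh (d := 3) Lc 0)) = (scaleK (Sum.elim (fun _ : Fin (3 + 1) => (1 : ℝ)) (fun _ : Fin (3 + 1) => (uF 0)⁻¹)) (Sum.elim (fun _ : Fin (3 + 1) => (1 : ℝ)) (fun _ : Fin (3 + 1) => (uF 0)⁻¹)) (GcombSh (d := 3) Lc 0)) := by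
  intro t
  rw [pow_one, shiftK_scaleK, shiftK_GcombSh']

/-- [folklore] **THE STOREY-1 CHART DECAYS** (`∃`-form of v10's `hAF hαF` at `n := 0`, same σ₀): an2 `decays_GcombSh` through lit `decays_scaleK` (`|σ₀ a| ≤ Σ |σ₀ a′|`). -/
theorem exists_decays_AF_zero : ∃ δ C : ℝ, 0 < δ ∧ 0 ≤ C ∧ Decays (scaleK (Sum.elim (fun _ : Fin (3 + 1) => (1 : ℝ)) (fun _ : Fin (3 + 1) => (uF 0)⁻¹)) (Sum.elim (fun _ : Fin (3 + 1) => (1 : ℝ)) (fun _ : Fin (3 + 1) => (uF 0)⁻¹)) (GcombSh (d := 3) Lc 0)) C δ := by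
  obtain ⟨δ, C, hδ, hC, hA⟩ := decays_GcombSh (d := 3) Lc 0
  set σ : Fib 3 → ℝ := Sum.elim (fun _ : Fin (3 + 1) => (1 : ℝ)) (fun _ : Fin (3 + 1) => (uF 0)⁻¹) with hσ_def
  have hσ : ∀ a : Fib 3, |σ a| ≤ ∑ a', |σ a'| := fun a => Finset.single_le_sum (fun a' _ => abs_nonneg (σ a')) (Finset.mem_univ a)
  exact ⟨δ, (∑ a', |σ a'|) * C * ∑ a', |σ a'|, hδ,
    mul_nonneg (mul_nonneg (Finset.sum_nonneg fun _ _ => abs_nonneg _) hC) (Finset.sum_nonneg fun _ _ => abs_nonneg _), decays_scaleK hσ hσ hA⟩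

end Chart

/-! ## §3 The dressed literal families ARE vertex families at blocking `Lc·Lc` (v10's `hVF hWF hδF` at `n := 0`, `∃`-form) -/

section Families

variable (Lc : ℕ) [NeZero Lc] (hLc : Odd Lc) (N : ℕ) (cΛ cB : ℝ) (uF : ℕ → ℝ)

/-- [folklore] **THE σ′₀-SCALED DRESSED LITERAL FAMILIES ARE VERTEX FAMILIES** at blocking `Lc·Lc` with ONE common rate: FILE 1 §3 (`vertexFamily_dressV ∕
vertexFamily₂_dressW`) fed §1 `vertexFamilies_G0` and `TowerFTransportRow.abs_wStep_le`, then lit `biLoc_smul` and `biLoc_scaleK` (`|σ′₀| ≤ uF 0` for `1 ≤ uF 0`).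
The END's skeleton N feeds `NF 0 := Lc·Lc`, `CvF 0, CwF 0, δF 0 := Classical.choose …`, `hVF 0, hWF 0, hδF 0 :=` the conjuncts. -/
theorem exists_vertexFamilies_FRec_zero (huF : 1 ≤ uF 0) : ∃ Cv Cw δ : ℝ, 0 < δ ∧
    VertexFamily (fun μ y => scaleK (Sum.elim (fun _ : Fin (3 + 1) => (1 : ℝ)) (fun _ : Fin (3 + 1) => (uF 0))) (Sum.elim (fun _ : Fin (3 + 1) => (1 : ℝ)) (fun _ : Fin (3 + 1) => (uF 0))) ((Lc : ℝ) ^ 4 • dressV Lc Lc (wStep Lc 1) (vertexOfK (GcombSh (d := 3) Lc 0) Lc (JsB12CombSh0 hLc N (symTablesAn1S2 3 Lc cΛ) cΛ cB 0).S) μ y)) (Lc * Lc) Cv δ ∧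
    VertexFamily₂ (fun μ y ν y' => scaleK (Sum.elim (fun _ : Fin (3 + 1) => (1 : ℝ)) (fun _ : Fin (3 + 1) => (uF 0))) (Sum.elim (fun _ : Fin (3 + 1) => (1 : ℝ)) (fun _ : Fin (3 + 1) => (uF 0))) ((Lc : ℝ) ^ 8 • dressW Lc Lc (wStep Lc 1) (JsB12CombSh0 hLc N (symTablesAn1S2 3 Lc cΛ) cΛ cB 0).W μ y ν y')) (Lc * Lc) Cw δ := by
  obtain ⟨Cv, Cw, δ, hδ, hV, hW⟩ := vertexFamilies_G0 Lc hLc N cΛ cB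
  obtain ⟨δw, Cw0, hδw, hCw0, hw⟩ := abs_wStep_le Lc 1
  have hV' := vertexFamily_dressV (N := Lc) Lc (w := wStep Lc 1) (fun c a u => hw c a u) hCw0 hδw hV hδ
  have hW' := vertexFamily₂_dressW (N := Lc) Lc (w := wStep Lc 1) (fun c a u => hw c a u) hCw0 hδw hW hδ
  have hNpos : (0 : ℝ) < ((Lc : ℕ) : ℝ) := by exact_mod_cast Nat.pos_of_ne_zero (NeZero.ne Lc)
  have hm : 0 < min (δw / ((Lc : ℕ) : ℝ)) δ := lt_min (div_pos hδw hNpos) hδ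
  have hs := fun a => abs_fibSigma'_le (d := 3) huF a
  have hle : min (δw / ((Lc : ℕ) : ℝ)) δ / 2 / 2 ≤ min (δw / ((Lc : ℕ) : ℝ)) δ / 2 := by linarith [half_pos hm]
  have hV'' : VertexFamily (fun μ y => scaleK (Sum.elim (fun _ : Fin (3 + 1) => (1 : ℝ)) (fun _ : Fin (3 + 1) => (uF 0)))
      (Sum.elim (fun _ : Fin (3 + 1) => (1 : ℝ)) (fun _ : Fin (3 + 1) => (uF 0)))
      ((Lc : ℝ) ^ 4 • dressV Lc Lc (wStep Lc 1) (vertexOfK (GcombSh (d := 3) Lc 0) Lc (JsB12CombSh0 hLc N (symTablesAn1S2 3 Lc cΛ) cΛ cB 0).S) μ y)) (Lc * Lc)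
      (uF 0 * (|(Lc : ℝ) ^ 4| * |∑ _c : Fin (3 + 1), Cw0 * |Cv| * ExpKernelCalculus.Zl (3 + 1) (min (δw / ((Lc : ℕ) : ℝ)) δ / 2)|) * uF 0)
      (min (δw / ((Lc : ℕ) : ℝ)) δ / 2 / 2) :=
    fun μ y => biLoc_scaleK hs hs (biLoc_smul ((Lc : ℝ) ^ 4) (biLoc_of_le (hV' μ y) hle))
  have hW'' : VertexFamily₂ (fun μ y ν y' => scaleK (Sum.elim (fun _ : Fin (3 + 1) => (1 : ℝ)) (fun _ : Fin (3 + 1) => (uF 0)))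
      (Sum.elim (fun _ : Fin (3 + 1) => (1 : ℝ)) (fun _ : Fin (3 + 1) => (uF 0)))
      ((Lc : ℝ) ^ 8 • dressW Lc Lc (wStep Lc 1) (JsB12CombSh0 hLc N (symTablesAn1S2 3 Lc cΛ) cΛ cB 0).W μ y ν y')) (Lc * Lc)
      (uF 0 * (|(Lc : ℝ) ^ 8| * (∑ _c : Fin (3 + 1), ∑ _e : Fin (3 + 1),
        Cw0 * (Cw0 * |Cw| * ExpKernelCalculus.Zl (3 + 1) (min (δw / ((Lc : ℕ) : ℝ)) δ / 2))
          * ExpKernelCalculus.Zl (3 + 1) (min (δw / ((Lc : ℕ) : ℝ)) δ / 2 / 2))) * uF 0)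
      (min (δw / ((Lc : ℕ) : ℝ)) δ / 2 / 2) :=
    fun μ y ν y' => biLoc_scaleK hs hs (biLoc_smul ((Lc : ℝ) ^ 8) (hW' μ y ν y'))
  exact ⟨_, _, _, half_pos (half_pos hm), hV'', hW''⟩

end Families

/-! ## §4 THE DEPTH-1 ANCHOR ROW AT THE RECORD -/

section Anchor

variable (Lc : ℕ) [NeZero Lc] (hLc : Odd Lc) (N : ℕ) (cΛ cB : ℝ) (Pn : Pins) (uF : ℕ → ℝ)

/-- [folklore] **`hF₁` AT THE RECORD** — v10 `StepRecursionFeedNestedNamedI.d1Tel_JcComp_ctr_namedI`'s binder `hF₁` (L.276) CHARACTER FOR CHARACTER under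
σ₀ = {`(AF 1)` ↦ `scaleK σ₀ σ₀ (GcombSh Lc 0)`, `(𝒱F 1)` ↦ `fun μ y => scaleK σ′₀ σ′₀ ((Lc : ℝ) ^ 4 • dressV Lc Lc (wStep Lc 1) (vertexOfK (GcombSh Lc 0) Lc (JsB12CombSh0 … 0).S) μ y)`,
`(𝒲F 1)` ↦ `fun μ y ν y' => scaleK σ′₀ σ′₀ ((Lc : ℝ) ^ 8 • dressW Lc Lc (wStep Lc 1) (JsB12CombSh0 … 0).W μ y ν y')`} (any unit `uF 0 ≠ 0`): the units cancel
(`hessKer_scaleK`); `TshotOf Lc JcComp 1 = TbalOf Lc Js 0` (`TshotOf_JcComp_one`, depth 1 IS the literal) `= hessKer G′₀ VG⁰ WG⁰` (`TbalOf_JsB12CombShSym`);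
and FILE 2's `hessKer_dressV_dressW` at `N := Lc`, `L := Lc`, `w := wStep Lc 1` fed §1 + an2 `decays_GcombSh ∕ shiftK_GcombSh'` + `JsB12CombSh0_W_translate` is the row. -/
theorem hF₁_rec (huF : uF 0 ≠ 0) : ∀ (μ ν : Fin 4) (z : Fin 4 → ℤ), hessKer (scaleK (Sum.elim (fun _ : Fin (3 + 1) => (1 : ℝ)) (fun _ : Fin (3 + 1) => (uF 0)⁻¹)) (Sum.elim (fun _ : Fin (3 + 1) => (1 : ℝ)) (fun _ : Fin (3 + 1) => (uF 0)⁻¹)) (GcombSh (d := 3) Lc 0)) (fun μ y => scaleK (Sum.elim (fun _ : Fin (3 + 1) => (1 : ℝ)) (fun _ : Fin (3 + 1) => (uF 0))) (Sum.elim (fun _ : Fin (3 + 1) => (1 : ℝ)) (fun _ : Fin (3 + 1) => (uF 0))) ((Lc : ℝ) ^ 4 • dressV Lc Lc (wStep Lc 1) (vertexOfK (GcombSh (d := 3) Lc 0) Lc (JsB12CombSh0 hLc N (symTablesAn1S2 3 Lc cΛ) cΛ cB 0).S) μ y)) (fun μ y ν y' => scaleK (Sum.elim (fun _ : Fin (3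 + 1) => (1 : ℝ)) (fun _ : Fin (3 + 1) => (uF 0))) (Sum.elim (fun _ : Fin (3 + 1) => (1 : ℝ)) (fun _ : Fin (3 + 1) => (uF 0))) ((Lc : ℝ) ^ 8 • dressW Lc Lc (wStep Lc 1) (JsB12CombSh0 hLc N (symTablesAn1S2 3 Lc cΛ) cΛ cB 0).W μ y ν y')) μ ν z = (Lc : ℝ) ^ 8 * dressedEntry (wStep Lc 1) (TshotOf Lc (JcComp hLc N cΛ cB (Roots.ctr Lc) Pn) 1) ((Lc : ℤ) • z) μ ν := by
  intro μ ν z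
  have hσσ : ∀ a : Fib 3, Sum.elim (fun _ : Fin (3 + 1) => (1 : ℝ)) (fun _ : Fin (3 + 1) => (uF 0)⁻¹) a
      * Sum.elim (fun _ : Fin (3 + 1) => (1 : ℝ)) (fun _ : Fin (3 + 1) => (uF 0)) a = 1 := fun a => fibreScale_mul_inv huF a
  rw [hessKer_scaleK _ _ hσσ (GcombSh (d := 3) Lc 0)
    (fun μ y => (Lc : ℝ) ^ 4 • dressV Lc Lc (wStep Lc 1) (vertexOfK (GcombSh (d := 3) Lc 0) Lc (JsB12CombSh0 hLc N (symTablesAn1S2 3 Lc cΛ) cΛ cB 0).S) μ y)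
    (fun μ y ν y' => (Lc : ℝ) ^ 8 • dressW Lc Lc (wStep Lc 1) (JsB12CombSh0 hLc N (symTablesAn1S2 3 Lc cΛ) cΛ cB 0).W μ y ν y')]
  rw [TshotOf_JcComp_one, TbalOf_JsB12CombShSym]
  -- the literal's letters
  obtain ⟨δA, CA, hδA, -, hA⟩ := decays_GcombSh (d := 3) Lc 0
  obtain ⟨Cv, Cw, δ, hδ, hV, hW⟩ := vertexFamilies_G0 Lc hLc N cΛ cB
  obtain ⟨δw, Cw0, hδw, hCw0, hw⟩ := abs_wStep_le Lc 1
  have hid := hessKer_dressV_dressW (N := Lc) Lc (w := wStep Lc 1) (A := GcombSh (d := 3) Lc 0)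
    (V := vertexOfK (GcombSh (d := 3) Lc 0) Lc (JsB12CombSh0 hLc N (symTablesAn1S2 3 Lc cΛ) cΛ cB 0).S)
    (W := (JsB12CombSh0 hLc N (symTablesAn1S2 3 Lc cΛ) cΛ cB 0).W) ⟨CA, δA, hδA, hA⟩ (fun s => shiftK_GcombSh' (d := 3) 0 s)
    (fun c a u => hw c a u) hCw0 hδw hV hW hδ (VG0_translate Lc hLc N cΛ cB)
    (fun c t e t' s => JsB12CombSh0_W_translate hLc N (symTablesAn1S2 3 Lc cΛ) cΛ cB 0 c t e t' s) μ ν z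
  rw [← hid]
  simp only [ExpKernelCalculus.hessKer]
  rw [tadpole_smul, bubble_smul_left, bubble_smul_right]
  ring

end Anchor

end Summit.QuantumFields.BalabanUV.Beta.FP.TowerFAnchorRow

end
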